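import Summits.MatrixMultiplication.MatrixMultiplication.Theorems.EdgePencilRerouting
import Summits.MatrixMultiplication.MatrixMultiplication.Theorems.EdgePencilTriangles
import Summits.MatrixMultiplication.MatrixMultiplication.Theorems.EdgePencilFatEnd
import HarnessLib

/-!
# The three-triangle re-routing cover of `W^{(δ)}` at tensor level, and `1/2 < α ⟹ SixRungPos`

Support kernel for `stmt-MatrixMultiplication-26697` (`TetraExcessZero : ω(K₄) ≤ ω(2,1,2)`, route
`TetrahedronCarving`; line `Cruxes/TetraExcessZero/Lines/rung_and_chord.lean`, first stub
`stub_sixRungPos : ∃ δ > 0, χ(δ) ≤ ω(2,1,2)`), unit `cruxidea-stmt-MatrixMultiplication-26697-1`.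

`EdgePencilRerouting` §3–§4 proved `1/2 < α ⟹ ∃ δ > 0, χ(δ) ≤ ω(2,1,2)` MODULO the exponent shadow
`hB : χ(δ) ≤ ω(x,x,δ) + 2ω(1−x,1,1/2)` of a cover of the graph tensor `W^{(δ)}` (bond `δ` on `01`, `1`
elsewhere) by three rectangular matrix-multiplication triangles: a THIN triangle `012` carrying the pendant
edge `01` and an `n^x`-part of `02, 12`, and two triangles `023`, `123` carrying the complementary
`n^{1−x}`-parts of `02, 12`, the full edges `03, 13` and the two halves of `23`. This file discharges `hB`
at tensor level in the cube format of `tensorRankD` (labels of `02, 12` split into residue mod `m` and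
quotient, labels of `23` into residue mod `d₁` and quotient — the plumbing of
`EdgePencilTriangles.pencil_eq_sum_twoTriangles` with a third triangle in place of the deleted edge):

* §1 `sum_triad_dite`: the triangle identity with factors extended by zero in both coordinates;
  `sixTetra_apply`.
* §2 `exists_sixTetra_eq_sum_threeTriangles`, `tensorRankD_sixTetra_le_threeTriangles`:
  `R₄(W_n^{(e)}) ≤ R(⟨m,e,m⟩)·R(⟨q,d₁,n⟩)·R(⟨q,d₂,n⟩)` for `n ≤ m q`, `n ≤ d₁ d₂`.
* §3 `omegaSix_le_reroute`: `χ(δ) ≤ ω(x,δ,x) + 2ω(1−x,1/2,1)` for EVERY real `x, δ` (no hypotheses: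
  `⌈n^x⌉⌈n^{1−x}⌉ ≥ n` always); `reroutingBound` is the `hB`-shaped form.
* §4 over `ℂ`: `sixRungPos_of_half_lt_dualExponentAlpha` (`1/2 < α ⟹` the statement of
  `stub_sixRungPos`), `omegaSix_le_four_of_half_lt_dualExponentAlpha`,
  `tetraExcessZero_iff_midTight_of_half_lt_dualExponentAlpha` (under strict HalfAlpha the crux IS its
  midpoint half `ω(2,1,2) + ω(K₄) ≤ 2χ(1/2)`).

Placement, no more: the rung `SixRungPos` is at most as strong as strict HalfAlpha (`1/2 < α`, open, far
beyond the record `α > 0.321334`); with `EdgePencilRerouting` §5 (every placed matrix-multiplication cover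
certificate of a rung forces `1/2 ≤ α`) this brackets what covers do for the rung: they certify it iff — up
to the boundary case `α = 1/2` — HalfAlpha holds. Nothing here proves `ω = 2`, `α > 1/2`, or the rung.

References: Christandl–Vrana–Zuiddam, arXiv:1609.07476, Prop. 1.1.16, Prop. 1.1.26
[ChristandlVranaZuiddam2016]; Lotti–Romani 1983 [LottiRomani1983]; Le Gall 2012 §1 [LeGall2012].
-/


noncomputable section

set_option linter.dupNamespace false

open scoped BigOperators
open Filter Asymptotics Literature.Computability.AlgebraicComplexity
open Summit.MatrixMultiplication.MatrixMultiplication.Theorems.TetrahedronTensor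
open Summit.MatrixMultiplication.MatrixMultiplication.Theorems.TetraDiagonal
open Summit.MatrixMultiplication.MatrixMultiplication.Theses.TetrahedronCarving

namespace Summit.MatrixMultiplication.MatrixMultiplication.Theorems.EdgePencil

/-! ## §1 The triangle identity with factors extended by zero in both coordinates -/

section Ext

variable {F : Type*} [Field F]

/-- **The triangle identity with zero-extended factors**: from `⟨k, m, l⟩ = ∑_j w_j ⊗ u_j ⊗ v_j`
(`w_j` on `Fin k × Fin l`, `u_j` on `Fin k × Fin m`, `v_j` on `Fin m × Fin l`), for labels in `Fin n`,
`∑_j w̃_j(x,z) ũ_j(x',y) ṽ_j(y',z') = [x < k ∧ y < m ∧ z < l ∧ x = x' ∧ y = y' ∧ z = z']`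
(`~` = extension by zero). (CVZ19 Prop. 1.1.16). -/
theorem sum_triad_dite {n k m l r : ℕ} {w : Fin r → Fin k × Fin l → F}
    {u : Fin r → Fin k × Fin m → F} {v : Fin r → Fin m × Fin l → F}
    (hdec : matMulTensor F k m l = ∑ j, triad (w j) (u j) (v j)) (x z x' y y' z' : Fin n) :
    ∑ j, (if h : (x : ℕ) < k ∧ (z : ℕ) < l then w j (⟨x, h.1⟩, ⟨z, h.2⟩) else 0) *
        (if h : (x' : ℕ) < k ∧ (y : ℕ) < m then u j (⟨x', h.1⟩, ⟨y, h.2⟩) else 0) *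
        (if h : (y' : ℕ) < m ∧ (z' : ℕ) < l then v j (⟨y', h.1⟩, ⟨z', h.2⟩) else 0) =
      ind ((x : ℕ) < k ∧ (y : ℕ) < m ∧ (z : ℕ) < l ∧ (x = x' ∧ y = y' ∧ z = z')) := by
  classical
  by_cases hall : ((x : ℕ) < k ∧ (z : ℕ) < l) ∧ ((x' : ℕ) < k ∧ (y : ℕ) < m) ∧
      ((y' : ℕ) < m ∧ (z' : ℕ) < l)
  · obtain ⟨hw, hu, hv⟩ := hall
    have h := congrFun (congrFun (congrFun hdec (⟨x, hw.1⟩, ⟨z, hw.2⟩)) (⟨x', hu.1⟩, ⟨y, hu.2⟩))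
      (⟨y', hv.1⟩, ⟨z', hv.2⟩)
    rw [Finset.sum_apply, Finset.sum_apply, Finset.sum_apply] at h
    simp only [triad_apply, matMulTensor] at h
    simp only [dif_pos hw, dif_pos hu, dif_pos hv]
    rw [← h, ind]
    refine if_congr ?_ rfl rfl
    simp only [Fin.ext_iff]
    tauto
  · have hz : ∀ j, (if h : (x : ℕ) < k ∧ (z : ℕ) < l then w j (⟨x, h.1⟩, ⟨z, h.2⟩) else 0) *
        (if h : (x' : ℕ) < k ∧ (y : ℕ) < m then u j (⟨x', h.1⟩, ⟨y, h.2⟩) else 0) *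
        (if h : (y' : ℕ) < m ∧ (z' : ℕ) < l then v j (⟨y', h.1⟩, ⟨z', h.2⟩) else 0) = 0 :=
      fun j => by
      by_cases hw : (x : ℕ) < k ∧ (z : ℕ) < l
      · by_cases hu : (x' : ℕ) < k ∧ (y : ℕ) < m
        · have hv : ¬((y' : ℕ) < m ∧ (z' : ℕ) < l) := fun hv => hall ⟨hw, hu, hv⟩
          simp [dif_neg hv]
        · simp [dif_neg hu]
      · simp [dif_neg hw]
    rw [Finset.sum_congr rfl fun j _ => hz j, Finset.sum_const_zero, ind, if_neg]
    rintro ⟨hxk, hym, hzl, hxx, hyy, hzz⟩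
    refine hall ⟨⟨hxk, hzl⟩, ⟨?_, hym⟩, ?_, ?_⟩
    · rw [← hxx]; exact hxk
    · rw [← hyy]; exact hym
    · rw [← hzz]; exact hzl

/-- The thin slot-`0` indicator is the indicator of `lab x 0 < e`. -/
theorem thinInd_zero_eq' {n e : ℕ} (x : Fin (n ^ 3)) :
    thinInd F n e 0 x = ind ((lab x 0 : ℕ) < e) := rfl

/-- **Pointwise value of `W_n^{(e)}`.** -/
theorem sixTetra_apply {n e : ℕ} (i : Fin 4 → Fin (n ^ 3)) :
    sixTetra F n e i = ind (((lab (i 0) 0 : ℕ) < e) ∧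
      (lab (i 0) 0 = lab (i 1) 0 ∧ lab (i 0) 1 = lab (i 2) 0 ∧ lab (i 0) 2 = lab (i 3) 0 ∧
        lab (i 1) 1 = lab (i 2) 1 ∧ lab (i 1) 2 = lab (i 3) 1 ∧ lab (i 2) 2 = lab (i 3) 2)) := by
  rw [sixTetra, thinInd_zero_eq', tetra_eq_ind, ind_mul_ind]

end Ext

/-! ## §2 The three-triangle decomposition of `W_n^{(e)}` -/

section ThreeTriangles

variable {F : Type*} [Field F]

/-- **The three-triangle decomposition of `W_n^{(e)}`**: from `⟨m, e, m⟩ = ∑ w₀ ⊗ u₀ ⊗ v₀` (triangle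
`012`: `02, 12` read mod `m`, `01` of bond `e`), `⟨q, d₁, n⟩ = ∑ w₁ ⊗ u₁ ⊗ v₁` (triangle `023`: `02` read
div `m`, `23` mod `d₁`, `03` full), `⟨q, d₂, n⟩ = ∑ w₂ ⊗ u₂ ⊗ v₂` (triangle `123`: `12` div `m`, `23` div
`d₁`, `13` full), `n ≤ m q` and `n ≤ d₁ d₂`, the tensor `W_n^{(e)}` is a sum of `r₀ r₁ r₂` rank-one tensors
(legs indexed by `(j₀, j₁, j₂)`; slots `0 ↦ (01,02,03)`, `1 ↦ (01,12,13)`, `2 ↦ (02,12,23)`,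
`3 ↦ (03,13,23)`). [cite: ChristandlVranaZuiddam2016, Prop. 1.1.16, Prop. 1.1.26] -/
theorem exists_sixTetra_eq_sum_threeTriangles {n m e q d₁ d₂ r₀ r₁ r₂ : ℕ} (hmq : n ≤ m * q)
    (hd : n ≤ d₁ * d₂)
    {w₀ : Fin r₀ → Fin m × Fin m → F} {u₀ : Fin r₀ → Fin m × Fin e → F}
    {v₀ : Fin r₀ → Fin e × Fin m → F}
    {w₁ : Fin r₁ → Fin q × Fin n → F} {u₁ : Fin r₁ → Fin q × Fin d₁ → F}
    {v₁ : Fin r₁ → Fin d₁ × Fin n → F}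
    {w₂ : Fin r₂ → Fin q × Fin n → F} {u₂ : Fin r₂ → Fin q × Fin d₂ → F}
    {v₂ : Fin r₂ → Fin d₂ × Fin n → F}
    (hdec₀ : matMulTensor F m e m = ∑ j, triad (w₀ j) (u₀ j) (v₀ j))
    (hdec₁ : matMulTensor F q d₁ n = ∑ j, triad (w₁ j) (u₁ j) (v₁ j))
    (hdec₂ : matMulTensor F q d₂ n = ∑ j, triad (w₂ j) (u₂ j) (v₂ j)) :
    ∃ L : Fin r₀ × Fin r₁ × Fin r₂ → Fin 4 → Fin (n ^ 3) → F,
      ∑ s, rankOneTensor (L s) = sixTetra F n e := by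
  classical
  -- zero-extensions of the nine factors, as functions of two labels
  let W₀ : Fin r₀ → Fin n → Fin n → F := fun j y z =>
    if h : (y : ℕ) < m ∧ (z : ℕ) < m then w₀ j (⟨y, h.1⟩, ⟨z, h.2⟩) else 0
  let U₀ : Fin r₀ → Fin n → Fin n → F := fun j y z =>
    if h : (y : ℕ) < m ∧ (z : ℕ) < e then u₀ j (⟨y, h.1⟩, ⟨z, h.2⟩) else 0
  let V₀ : Fin r₀ → Fin n → Fin n → F := fun j y z =>
    if h : (y : ℕ) < e ∧ (z : ℕ) < m then v₀ j (⟨y, h.1⟩, ⟨z, h.2⟩) else 0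
  let W₁ : Fin r₁ → Fin n → Fin n → F := fun j y z =>
    if h : (y : ℕ) < q ∧ (z : ℕ) < n then w₁ j (⟨y, h.1⟩, ⟨z, h.2⟩) else 0
  let U₁ : Fin r₁ → Fin n → Fin n → F := fun j y z =>
    if h : (y : ℕ) < q ∧ (z : ℕ) < d₁ then u₁ j (⟨y, h.1⟩, ⟨z, h.2⟩) else 0
  let V₁ : Fin r₁ → Fin n → Fin n → F := fun j y z =>
    if h : (y : ℕ) < d₁ ∧ (z : ℕ) < n then v₁ j (⟨y, h.1⟩, ⟨z, h.2⟩) else 0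
  let W₂ : Fin r₂ → Fin n → Fin n → F := fun j y z =>
    if h : (y : ℕ) < q ∧ (z : ℕ) < n then w₂ j (⟨y, h.1⟩, ⟨z, h.2⟩) else 0
  let U₂ : Fin r₂ → Fin n → Fin n → F := fun j y z =>
    if h : (y : ℕ) < q ∧ (z : ℕ) < d₂ then u₂ j (⟨y, h.1⟩, ⟨z, h.2⟩) else 0
  let V₂ : Fin r₂ → Fin n → Fin n → F := fun j y z =>
    if h : (y : ℕ) < d₂ ∧ (z : ℕ) < n then v₂ j (⟨y, h.1⟩, ⟨z, h.2⟩) else 0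
  refine ⟨fun s => ![fun x => U₀ s.1 (modLab m (lab x 1)) (lab x 0) * W₁ s.2.1 (divLab m (lab x 1)) (lab x 2),
    fun x => V₀ s.1 (lab x 0) (modLab m (lab x 1)) * W₂ s.2.2 (divLab m (lab x 1)) (lab x 2),
    fun x => W₀ s.1 (modLab m (lab x 0)) (modLab m (lab x 1)) *
      U₁ s.2.1 (divLab m (lab x 0)) (modLab d₁ (lab x 2)) *
      U₂ s.2.2 (divLab m (lab x 1)) (divLab d₁ (lab x 2)),
    fun x => V₁ s.2.1 (modLab d₁ (lab x 2)) (lab x 0) * V₂ s.2.2 (divLab d₁ (lab x 2)) (lab x 1)], ?_⟩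
  funext i
  set X : Fin r₀ → F := fun j => W₀ j (modLab m (lab (i 2) 0)) (modLab m (lab (i 2) 1)) *
    U₀ j (modLab m (lab (i 0) 1)) (lab (i 0) 0) * V₀ j (lab (i 1) 0) (modLab m (lab (i 1) 1)) with hX
  set Y : Fin r₁ → F := fun j => W₁ j (divLab m (lab (i 0) 1)) (lab (i 0) 2) *
    U₁ j (divLab m (lab (i 2) 0)) (modLab d₁ (lab (i 2) 2)) *
      V₁ j (modLab d₁ (lab (i 3) 2)) (lab (i 3) 0) with hY
  set Z : Fin r₂ → F := fun j => W₂ j (divLab m (lab (i 1) 1)) (lab (i 1) 2) *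
    U₂ j (divLab m (lab (i 2) 1)) (divLab d₁ (lab (i 2) 2)) *
      V₂ j (divLab d₁ (lab (i 3) 2)) (lab (i 3) 1) with hZ
  have hsumX : ∑ j, X j = ind ((((modLab m (lab (i 2) 0) : Fin n) : ℕ) < m) ∧
      ((lab (i 0) 0 : ℕ) < e) ∧ (((modLab m (lab (i 2) 1) : Fin n) : ℕ) < m) ∧
      (modLab m (lab (i 2) 0) = modLab m (lab (i 0) 1) ∧ lab (i 0) 0 = lab (i 1) 0 ∧
        modLab m (lab (i 2) 1) = modLab m (lab (i 1) 1))) :=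
    sum_triad_dite hdec₀ _ _ _ _ _ _
  have hsumY : ∑ j, Y j = ind ((((divLab m (lab (i 0) 1) : Fin n) : ℕ) < q) ∧
      (((modLab d₁ (lab (i 2) 2) : Fin n) : ℕ) < d₁) ∧ ((lab (i 0) 2 : ℕ) < n) ∧
      (divLab m (lab (i 0) 1) = divLab m (lab (i 2) 0) ∧
        modLab d₁ (lab (i 2) 2) = modLab d₁ (lab (i 3) 2) ∧ lab (i 0) 2 = lab (i 3) 0)) :=
    sum_triad_dite hdec₁ _ _ _ _ _ _
  have hsumZ : ∑ j, Z j = ind ((((divLab m (lab (i 1) 1) : Fin n) : ℕ) < q) ∧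
      (((divLab d₁ (lab (i 2) 2) : Fin n) : ℕ) < d₂) ∧ ((lab (i 1) 2 : ℕ) < n) ∧
      (divLab m (lab (i 1) 1) = divLab m (lab (i 2) 1) ∧
        divLab d₁ (lab (i 2) 2) = divLab d₁ (lab (i 3) 2) ∧ lab (i 1) 2 = lab (i 3) 1)) :=
    sum_triad_dite hdec₂ _ _ _ _ _ _
  have hXYZ : ∑ s : Fin r₀ × Fin r₁ × Fin r₂, X s.1 * (Y s.2.1 * Z s.2.2) =
      (∑ j₀, X j₀) * ((∑ j₁, Y j₁) * ∑ j₂, Z j₂) := by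
    rw [Finset.sum_mul_sum, Finset.sum_mul_sum]
    simp only [Finset.mul_sum, Fintype.sum_prod_type]
  rw [Finset.sum_apply]
  calc ∑ s : Fin r₀ × Fin r₁ × Fin r₂, rankOneTensor (![
        fun x => U₀ s.1 (modLab m (lab x 1)) (lab x 0) * W₁ s.2.1 (divLab m (lab x 1)) (lab x 2),
        fun x => V₀ s.1 (lab x 0) (modLab m (lab x 1)) * W₂ s.2.2 (divLab m (lab x 1)) (lab x 2),
        fun x => W₀ s.1 (modLab m (lab x 0)) (modLab m (lab x 1)) *
          U₁ s.2.1 (divLab m (lab x 0)) (modLab d₁ (lab x 2)) *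
          U₂ s.2.2 (divLab m (lab x 1)) (divLab d₁ (lab x 2)),
        fun x => V₁ s.2.1 (modLab d₁ (lab x 2)) (lab x 0) *
          V₂ s.2.2 (divLab d₁ (lab x 2)) (lab x 1)]) i
      = ∑ s : Fin r₀ × Fin r₁ × Fin r₂, X s.1 * (Y s.2.1 * Z s.2.2) := by
        refine Finset.sum_congr rfl fun s _ => ?_
        rw [rankOneTensor_apply, Fin.prod_univ_four]
        simp only [Matrix.cons_val_zero, Matrix.cons_val_one, Matrix.cons_val_two,
          Matrix.cons_val_three, Matrix.head_cons, Matrix.tail_cons, hX, hY, hZ]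
        ring
    _ = (∑ j₀, X j₀) * ((∑ j₁, Y j₁) * ∑ j₂, Z j₂) := hXYZ
    _ = sixTetra F n e i := by
        rw [hsumX, hsumY, hsumZ, ind_mul_ind, ind_mul_ind, sixTetra_apply]
        simp only [ind, coe_modLab, coe_divLab]
        refine if_congr ?_ rfl rfl
        constructor
        · rintro ⟨⟨-, h01e, -, hr02, h01, hr12⟩, ⟨-, -, -, hq02, hs23, h03⟩, -, -, -, hq12, ht23, h13⟩
          refine ⟨h01e, h01, ?_, h03, ?_, h13, ?_⟩
          · exact (modLab_eq_and_divLab_eq_iff m _ _).1 ⟨hr02.symm, hq02⟩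
          · exact (modLab_eq_and_divLab_eq_iff m _ _).1 ⟨hr12.symm, hq12⟩
          · exact (modLab_eq_and_divLab_eq_iff d₁ _ _).1 ⟨hs23, ht23⟩
        · rintro ⟨h01e, h01, h02, h03, h12, h13, h23⟩
          have hlt : ((lab (i 0) 1 : Fin n) : ℕ) < m * q := lt_of_lt_of_le (lab (i 0) 1).2 hmq
          have hm : 0 < m := Nat.pos_of_ne_zero fun h => by
            rw [h, Nat.zero_mul] at hlt; exact Nat.not_lt_zero _ hlt
          have hlt' : ((lab (i 2) 2 : Fin n) : ℕ) < d₁ * d₂ := lt_of_lt_of_le (lab (i 2) 2).2 hd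
          have hd₁ : 0 < d₁ := Nat.pos_of_ne_zero fun h => by
            rw [h, Nat.zero_mul] at hlt'; exact Nat.not_lt_zero _ hlt'
          have hdivq : ∀ y : Fin n, (y : ℕ) / m < q := fun y =>
            (Nat.div_lt_iff_lt_mul hm).2 (by rw [Nat.mul_comm]; exact lt_of_lt_of_le y.2 hmq)
          have hdivd : ∀ y : Fin n, (y : ℕ) / d₁ < d₂ := fun y =>
            (Nat.div_lt_iff_lt_mul hd₁).2 (by rw [Nat.mul_comm]; exact lt_of_lt_of_le y.2 hd)
          refine ⟨⟨Nat.mod_lt _ hm, h01e, Nat.mod_lt _ hm, ?_, h01, ?_⟩,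
            ⟨hdivq _, Nat.mod_lt _ hd₁, (lab (i 0) 2).2, ?_, ?_, h03⟩,
            hdivq _, hdivd _, (lab (i 1) 2).2, ?_, ?_, h13⟩
          · rw [h02]
          · rw [h12]
          · rw [h02]
          · rw [h23]
          · rw [h12]
          · rw [h23]

/-- **Three-triangle bound** `R₄(W_n^{(e)}) ≤ R(⟨m, e, m⟩) · (R(⟨q, d₁, n⟩) · R(⟨q, d₂, n⟩))` for
`n ≤ m q`, `n ≤ d₁ d₂` (restriction of the bondwise Kronecker product of the three triangles).
[cite: ChristandlVranaZuiddam2016, Prop. 1.1.16, Prop. 1.1.26] -/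
theorem tensorRankD_sixTetra_le_threeTriangles {n m e q d₁ d₂ : ℕ} (hmq : n ≤ m * q)
    (hd : n ≤ d₁ * d₂) :
    tensorRankD (sixTetra F n e) ≤ tensorRank (matMulTensor F m e m) *
      (tensorRank (matMulTensor F q d₁ n) * tensorRank (matMulTensor F q d₂ n)) := by
  classical
  obtain ⟨w₀, u₀, v₀, hdec₀⟩ := exists_triad_decomposition_tensorRank (matMulTensor F m e m)
  obtain ⟨w₁, u₁, v₁, hdec₁⟩ := exists_triad_decomposition_tensorRank (matMulTensor F q d₁ n)
  obtain ⟨w₂, u₂, v₂, hdec₂⟩ := exists_triad_decomposition_tensorRank (matMulTensor F q d₂ n)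
  obtain ⟨L, hsum⟩ := exists_sixTetra_eq_sum_threeTriangles hmq hd hdec₀ hdec₁ hdec₂
  have hcard : Fintype.card (Fin (tensorRank (matMulTensor F m e m)) ×
      (Fin (tensorRank (matMulTensor F q d₁ n)) × Fin (tensorRank (matMulTensor F q d₂ n)))) =
      tensorRank (matMulTensor F m e m) *
        (tensorRank (matMulTensor F q d₁ n) * tensorRank (matMulTensor F q d₂ n)) := by simp
  rw [← hcard]
  let ε := Fintype.equivFin (Fin (tensorRank (matMulTensor F m e m)) ×
    (Fin (tensorRank (matMulTensor F q d₁ n)) × Fin (tensorRank (matMulTensor F q d₂ n))))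
  refine tensorRankD_le_of_eq_sum (fun k => L (ε.symm k)) ?_
  rw [← hsum]
  exact Fintype.sum_equiv ε.symm _ _ (fun _ => rfl)

/-- The symmetric split of the edge `23`: `R₄(W_n^{(e)}) ≤ R(⟨m, e, m⟩) · R(⟨q, d, n⟩)²` for `n ≤ m q`,
`n ≤ d²`. -/
theorem tensorRankD_sixTetra_le_threeTriangles_sq {n m e q d : ℕ} (hmq : n ≤ m * q)
    (hd : n ≤ d * d) :
    tensorRankD (sixTetra F n e) ≤
      tensorRank (matMulTensor F m e m) * tensorRank (matMulTensor F q d n) ^ 2 := by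
  rw [sq]
  exact tensorRankD_sixTetra_le_threeTriangles hmq hd

end ThreeTriangles

/-! ## §3 The re-routing bound in exponents: `χ(δ) ≤ ω(x, δ, x) + 2·ω(1 − x, 1/2, 1)` -/

section Exponent

variable (F : Type) [Field F]

/-- `n ≤ ⌈n^{1/2}⌉²`. [folklore] -/
theorem le_rectDim_half_mul_self (n : ℕ) : n ≤ rectDim n (1 / 2) * rectDim n (1 / 2) := by
  have h := le_rectDim_mul_rectDim n (1 / 2)
  norm_num at h
  exact h

/-- **Three-triangle cover in exponents**: `β` admissible for `⟨n^x, n^δ, n^x⟩` and `γ` admissible for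
`⟨n^{1−x}, n^{1/2}, n⟩` ⟹ `β + 2γ` admissible for the sixth-edge family `W^{(δ)}` (any real `x, δ`).
[cite: ChristandlVranaZuiddam2016, Prop. 1.1.26] -/
theorem add_two_mul_mem_sixAdmissibleExponents {x δ β γ : ℝ}
    (hβ : β ∈ rectAdmissibleExponents F x δ x)
    (hγ : γ ∈ rectAdmissibleExponents F (1 - x) (1 / 2) 1) :
    β + 2 * γ ∈ sixAdmissibleExponents F δ := by
  obtain ⟨C, hC0, hC⟩ := bound_of_isBigO_nat_atTop hβ
  obtain ⟨D, hD0, hD⟩ := bound_of_isBigO_nat_atTop hγ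
  refine IsBigO.of_bound (C * D ^ 2) ?_
  filter_upwards [eventually_ge_atTop 1] with n hn
  have hn0 : (0 : ℝ) < n := by exact_mod_cast hn
  have hR₀ : (tensorRank (matMulTensor F (rectDim n x) (rectDim n δ) (rectDim n x)) : ℝ) ≤
      C * (n : ℝ) ^ β := by
    have h := hC (Real.rpow_pos_of_pos hn0 β).ne'
    rwa [Real.norm_of_nonneg (Nat.cast_nonneg _), Real.norm_of_nonneg (Real.rpow_nonneg hn0.le _)]
      at h
  have hR₁ : (tensorRank (matMulTensor F (rectDim n (1 - x)) (rectDim n (1 / 2)) n) : ℝ) ≤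
      D * (n : ℝ) ^ γ := by
    have h := hD (Real.rpow_pos_of_pos hn0 γ).ne'
    rwa [Real.norm_of_nonneg (Nat.cast_nonneg _), Real.norm_of_nonneg (Real.rpow_nonneg hn0.le _),
      rectDim_one] at h
  rw [Real.norm_of_nonneg (Nat.cast_nonneg _), Real.norm_of_nonneg (Real.rpow_nonneg hn0.le _)]
  have hpow : (n : ℝ) ^ (β + 2 * γ) = (n : ℝ) ^ β * ((n : ℝ) ^ γ) ^ 2 := by
    rw [Real.rpow_add hn0, mul_comm (2 : ℝ) γ, Real.rpow_mul hn0.le, Real.rpow_two]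
  rw [hpow]
  have hfin := tensorRankD_sixTetra_le_threeTriangles_sq (F := F) (e := rectDim n δ)
    (le_rectDim_mul_rectDim n x) (le_rectDim_half_mul_self n)
  have hR₁0 : (0 : ℝ) ≤
      (tensorRank (matMulTensor F (rectDim n (1 - x)) (rectDim n (1 / 2)) n) : ℝ) :=
    Nat.cast_nonneg _
  calc (tensorRankD (sixTetra F n (rectDim n δ)) : ℝ)
      ≤ (tensorRank (matMulTensor F (rectDim n x) (rectDim n δ) (rectDim n x)) : ℝ) *
          (tensorRank (matMulTensor F (rectDim n (1 - x)) (rectDim n (1 / 2)) n) : ℝ) ^ 2 := by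
        exact_mod_cast hfin
    _ ≤ (C * (n : ℝ) ^ β) * (D * (n : ℝ) ^ γ) ^ 2 :=
        mul_le_mul hR₀ (pow_le_pow_left₀ hR₁0 hR₁ 2) (by positivity) (by positivity)
    _ = C * D ^ 2 * ((n : ℝ) ^ β * ((n : ℝ) ^ γ) ^ 2) := by ring

/-- **`χ(δ) ≤ ω(x, δ, x) + 2·ω(1 − x, 1/2, 1)`** for every real `x, δ`: the exponent of the
three-triangle cover (thin triangle `012` with loads `(x, x, δ)` on `(02, 12, 01)`; triangles `023`, `123`
with loads `(1 − x, 1, 1/2)`). [cite: ChristandlVranaZuiddam2016, Prop. 1.1.26] -/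
theorem omegaSix_le_reroute (x δ : ℝ) :
    omegaSix F δ ≤ omegaRect F x δ x + 2 * omegaRect F (1 - x) (1 / 2) 1 := by
  have h1 : ∀ γ ∈ rectAdmissibleExponents F (1 - x) (1 / 2) 1,
      omegaSix F δ - 2 * γ ≤ omegaRect F x δ x := fun γ hγ => by
    refine le_csInf (rectAdmissibleExponents_nonempty F x δ x) fun β hβ => ?_
    have h2 := csInf_le (sixAdmissibleExponents_bddBelow F δ)
      (add_two_mul_mem_sixAdmissibleExponents F hβ hγ)
    change omegaSix F δ ≤ β + 2 * γ at h2
    linarith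
  have h3 : ∀ γ ∈ rectAdmissibleExponents F (1 - x) (1 / 2) 1,
      (omegaSix F δ - omegaRect F x δ x) / 2 ≤ γ := fun γ hγ => by
    have h := h1 γ hγ
    linarith
  have h4 := le_csInf (rectAdmissibleExponents_nonempty F (1 - x) (1 / 2) 1) h3
  change (omegaSix F δ - omegaRect F x δ x) / 2 ≤ omegaRect F (1 - x) (1 / 2) 1 at h4
  linarith

/-- **The re-routing bound in the shape of `EdgePencilRerouting.sixRungPos_of_reroutingBound_of_half_lt`'s
hypothesis `hB`**: `χ(δ) ≤ ω(x, x, δ) + 2·ω(1 − x, 1, 1/2)` for every real `x, δ` (the hypotheses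
`0 < δ ≤ x ≤ 1` of `hB` are not needed). [cite: ChristandlVranaZuiddam2016, Prop. 1.1.26] -/
theorem reroutingBound (x δ : ℝ) :
    omegaSix F δ ≤ omegaRect F x x δ + 2 * omegaRect F (1 - x) 1 (1 / 2) := by
  rw [omegaRect_swap₂₃ F x x δ, omegaRect_swap₂₃ F (1 - x) 1 (1 / 2)]
  exact omegaSix_le_reroute F x δ

end Exponent

/-! ## §4 Corollaries over `ℂ`: strict HalfAlpha implies the rung -/

section Corollaries

/-- **`1/2 < α ⟹ SixRungPos`**: under strict HalfAlpha there is a rung `δ > 0` with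
`χ(δ) ≤ ω(2,1,2)` — the statement of `stub_sixRungPos` of the line `rung_and_chord`. (With
`x = 1 − 1/(2α)`, `δ = x·α₀`: `EdgePencilRerouting.reroutingCertificate_of_half_lt_dualExponentAlpha` and
the three-triangle cover.) [cite: LeGall2012, §1; Coppersmith1982, Thm 1] -/
theorem sixRungPos_of_half_lt_dualExponentAlpha (hα : (1 / 2 : ℝ) < dualExponentAlpha ℂ) :
    ∃ δ : ℝ, 0 < δ ∧ omegaSix ℂ δ ≤ omegaRect ℂ 2 1 2 := by
  obtain ⟨δ, hδ, h, -⟩ :=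
    sixRungPos_of_reroutingBound_of_half_lt (fun x δ _ _ _ => reroutingBound ℂ x δ) hα
  exact ⟨δ, hδ, h⟩

/-- **`1/2 < α ⟹ ∃ δ > 0, χ(δ) ≤ 4`**: under strict HalfAlpha a positive fraction of the sixth edge is
absorbed at the flat value. -/
theorem omegaSix_le_four_of_half_lt_dualExponentAlpha (hα : (1 / 2 : ℝ) < dualExponentAlpha ℂ) :
    ∃ δ : ℝ, 0 < δ ∧ omegaSix ℂ δ ≤ 4 := by
  obtain ⟨δ, hδ, -, h4⟩ :=
    sixRungPos_of_reroutingBound_of_half_lt (fun x δ _ _ _ => reroutingBound ℂ x δ) hα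
  exact ⟨δ, hδ, h4⟩

/-- **Under strict HalfAlpha the crux is its midpoint half**:
`1/2 < α ⟹ (TetraExcessZero ⟺ ω(2,1,2) + ω(K₄) ≤ 2·χ(1/2))` — the rung conjunct of
`tetraExcessZero_iff_sixRungPos_and_midTight` is discharged. -/
theorem tetraExcessZero_iff_midTight_of_half_lt_dualExponentAlpha
    (hα : (1 / 2 : ℝ) < dualExponentAlpha ℂ) :
    TetraExcessZero ↔ omegaRect ℂ 2 1 2 + omegaTetra ℂ ≤ 2 * omegaSix ℂ (1 / 2) := by
  rw [tetraExcessZero_iff_sixRungPos_and_midTight]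
  exact ⟨fun h => h.2, fun h => ⟨sixRungPos_of_half_lt_dualExponentAlpha hα, h⟩⟩

/-- **Placement of the rung**: `SixRungPos` is implied by strict HalfAlpha and (with `MidTight`) implies
the crux; so `(1/2 < α) ∧ MidTight ⟹ TetraExcessZero`. -/
theorem tetraExcessZero_of_half_lt_dualExponentAlpha_of_midTight
    (hα : (1 / 2 : ℝ) < dualExponentAlpha ℂ)
    (hmid : omegaRect ℂ 2 1 2 + omegaTetra ℂ ≤ 2 * omegaSix ℂ (1 / 2)) : TetraExcessZero :=
  tetraExcessZero_of_sixRungPos_of_midTight (sixRungPos_of_half_lt_dualExponentAlpha hα) hmid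

end Corollaries

end Summit.MatrixMultiplication.MatrixMultiplication.Theorems.EdgePencil

end
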